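import Summits.BirchSwinnertonDyer.BirchSwinnertonDyer.Theses.SemiOrdinaryEisensteinDescent
import Summits.BirchSwinnertonDyer.BirchSwinnertonDyer.Theorems.SemiOrdinaryEisensteinDescentWildSplitEisensteinInclusionAtThreeRankOneRestriction
import Summits.BirchSwinnertonDyer.Rank1Residual.X11b.AnticyclotomicEulerCharLinks
import Literature.NumberTheory.EllipticCurves.IwasawaAlgebra
import HarnessLib

/-!
# Crux E `WildSplitEisensteinInclusionAtThree` (stmt-BirchSwinnertonDyer-20479): the HIGHER-ANALYTIC-RANK corner in
# SELMER language — where `L(𝟙) = 0`, E makes `Sel_(∅,0)(K_∞, E[3^∞])^Γ` and `X_(∅,0)/T·X_(∅,0)` INFINITE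
# (cell `pub/bsd-wall`, width seat `bsd-wall-soed-p1-w3` g2, `--supports 20479`, helper; companion of
# `…WildSplitEisensteinInclusionAtThreeRankOneRestriction.lean`, p588074, which it imports)

Route `SemiOrdinaryEisensteinDescent` (SOED). The companion file records that crux E (#2) — unlike cruxes #3–#5 —
carries no rank-one datum binders and therefore also speaks at the Heegner fields `K` with `L(E^{(d_K)},1) = 0`
(`y_K` torsion), where it forces every generator of `Ch_Λ(X_(∅,0))` to vanish at `𝟙`. THIS FILE turns that
power-series statement into the SELMER statement of Skinner's `p`-converse step (Ann. of Math. 191 (2020),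
arXiv:1405.7294 p. 12, §2.7 display (11) «`L_𝔭^S(f,1) = 0 ⟹ #X_𝔭(f,K,S) = ∞`»), using only tree theorems:
Greenberg's Lemma 4.2 (`X/TX` finite ⟹ `f(0) ≠ 0`, Literature
`IwasawaAlgebra.constantCoeff_charGenerator_ne_zero_of_finite_coinvariants`) and its Selmer-side form for the
anticyclotomic dual pair (`X11b.exists_hasCharValuationAt_of_finite_invariants`: `Sel^Γ` finite ⟹ a generator
with `f(0) ≠ 0`), on top of the companion's `charGenerator_constantCoeff_eq_zero_of_crux` (E ⟹ where `L(𝟙) = 0`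
every generator vanishes at `𝟙`) and `constantCoeff_eq_zero_of_hasValueAt_sq_logOmega`.

* §2 **`not_finite_coinvariants_of_crux_of_constantCoeff_eq_zero`** — E ⟹ at every instance (binders and
  torsion guard VERBATIM) with `L(𝟙) = 0`: `X_(∅,0)/T·X_(∅,0)` is INFINITE; and
  **`not_finite_selmerInvariants_of_crux_of_constantCoeff_eq_zero`** — `Sel_(∅,0)(K_∞, E[3^∞])^{γ = 1}` is
  INFINITE (the tree's `IwasawaDual.endInvariants (conjSelmerAc … γ - 1)`).
* §3 **`not_finite_of_crux_of_isOfFinAddOrder`** — the same two conclusions at a TORSION point `P ∈ E(K)` under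
  the displayed value shape `L(𝟙) = c·(log_ω P / c(Dt))²` of crux #4 (any constant `c`, any `e : K → ℚ₃`;
  `log_ω P = 0` by `X11b.R1.logOmega_eq_zero_iff`): the corner `L(E^{(d_K)},1) = 0` of E, in which the route's
  kernel (`EisensteinKernelAtThree`, Friedberg–Hoffstein field WITH `L(E^{(d_K)},1) ≠ 0`) never operates.

HONEST STATUS: bookkeeping about what E asserts; nothing is asserted about the BDP value formula, about E, or
about any curve; no engine; the crux is NOT claimed false; BSD is not proved for any curve. Supports, does not
close, stmt-BirchSwinnertonDyer-20479.

References: [Skinner2020] §2.7 (arXiv:1405.7294 p. 12); [GreenbergLNM1716] §4 Lemma 4.2;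
[BertoliniDarmonPrasanna2013] Thm. 5.13; [Castella2018] §2.1, Thm. 2.3; [SilvermanAEC2009] IV.6.4.
-/

noncomputable section

open scoped Classical

set_option linter.dupNamespace false -- `Summit.BirchSwinnertonDyer.BirchSwinnertonDyer.Theorems.…` (summit = sub)
set_option autoImplicit false

namespace Summit.BirchSwinnertonDyer.BirchSwinnertonDyer.Theorems.WildSplitEisensteinInclusionAtThreeHigherRankCorner

open WeierstrassCurve NumberField IsDedekindDomain Field PowerSeries
  Literature.NumberTheory.EllipticCurves
  Literature.NumberTheory.EllipticCurves.IwasawaAlgebra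
  Summit.BirchSwinnertonDyer.Rank1Residual
  Summit.BirchSwinnertonDyer.Rank1Residual.X11b
  Summit.BirchSwinnertonDyer.Rank1Residual.X11b.AcSelmer
  Summit.BirchSwinnertonDyer.Rank1Residual.X11b.Halves
  Summit.BirchSwinnertonDyer.BirchSwinnertonDyer.Theses.SemiOrdinaryEisensteinDescent
  Summit.BirchSwinnertonDyer.BirchSwinnertonDyer.Theorems.WildSplitEisensteinInclusionAtThreeRankOneRestriction

/-! ### §2 The Selmer statements: infinite `X/TX` and infinite `Sel^Γ` where `L(𝟙) = 0` -/

/-- **E ⟹ where `L(𝟙) = 0`, `X_(∅,0)/T·X_(∅,0)` is INFINITE.** Binders and torsion guard of E VERBATIM, then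
`L(0) = 0 → ¬ Finite (X/TX)` for `X = X_ac(E_K[3^∞])` strict at `𝔭′`: `Ch_Λ(X)` is principal (`Λ` a UFD,
`charIdeal_isPrincipal_holds`), its generator vanishes at `𝟙` by E (companion §2), and Greenberg's Lemma 4.2
(`constantCoeff_charGenerator_ne_zero_of_finite_coinvariants`; `X` finitely generated by
`X11b.module_finite_XAc_baseChange`) forbids that when `X/TX` is finite. Skinner's display (11), `X`-side.
[cite: Skinner2020, §2.7 (arXiv:1405.7294 p. 12)] [cite: GreenbergLNM1716, §4 Lemma 4.2] -/
theorem not_finite_coinvariants_of_crux_of_constantCoeff_eq_zero (hE : WildSplitEisensteinInclusionAtThree) :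
    ∀ (W : WeierstrassCurve ℚ) [W.IsElliptic] [W.IsGloballyMinimal] (N : ℕ) [NeZero N] (K : Type) [Field K] [NumberField K] (Dt : Literature.NumberTheory.EllipticCurves.ModularForms.ModularParametrizationData W N), Summit.BirchSwinnertonDyer.Rank1Residual.Additive.ClassO6 W 3 → W.HasSurjectiveModNGaloisRep 3 → W.analyticRank = 1 → W.conductorNorm ℤ = N → Literature.NumberTheory.EllipticCurves.IsImaginaryQuadratic K → Literature.NumberTheory.EllipticCurves.SatisfiesHeegnerHypothesis N K → ∀ (κ : Literature.NumberTheory.EllipticCurves.ZpExtension K 3), κ.IsAnticyclotomic → ∀ (γ : Field.absoluteGaloisGroup K) [Fact (κ.IsTopGenerator γ)] (𝔭 : IsDedekindDomain.HeightOneSpectrum (NumberField.RingOfIntegers K)), ((3 : ℕ) : NumberField.RingOfIntegers K) ∈ 𝔭.asIdeal → 𝔭.asIdeal.ramificationIdx (NumberField.RingOfIntegers ℚ) = 1 → 𝔭.asIdeal.inertiaDeg (NumberField.RingOfIntegers ℚ) = 1 → ∀ (𝔭' : IsDedekindDomain.HeightOneSpectrum (NumberField.RingOfIntegers K)), ((3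 : ℕ) : NumberField.RingOfIntegers K) ∈ 𝔭'.asIdeal → 𝔭' ≠ 𝔭 → ∀ (ι' : PadicAlgCl 3 ≃+* ℂ), Summit.BirchSwinnertonDyer.BirchSwinnertonDyer.Theorems.SchneiderFree.BranchInducesPrime 3 ι' 𝔭 → ∀ (ΩK : ℂ) (Ωp : ℂ_[3]) (L : Literature.NumberTheory.EllipticCurves.UnrSeries 3), ΩK ≠ 0 → Ωp ≠ 0 → Literature.NumberTheory.EllipticCurves.IsBDPLFunction ι' 𝔭 κ γ Dt.f ΩK Ωp L → Module.IsTorsion (Literature.NumberTheory.EllipticCurves.IwasawaAlgebra 3) (Summit.BirchSwinnertonDyer.Rank1Residual.X11b.AcSelmer.XAc (W.baseChange K) 3 κ 𝔭' ∅ γ) → PowerSeries.constantCoeff L = 0 → ¬ Finite (Literature.NumberTheory.EllipticCurves.IwasawaAlgebra.coinvariants 3 (Summit.BirchSwinnertonDyer.Rank1Residual.X11b.AcSelmer.XAc (W.baseChange K) 3 κ 𝔭' ∅ γ)) := by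
  intro W _ _ N _ K _ _ Dt hO6 hsurj hr1 hN hK hH κ hκ γ _ 𝔭 h𝔭 he hf 𝔭' h𝔭' hne ι' hι ΩK Ωp L hΩK hΩp hL htor hL0 hfin
  haveI := module_finite_XAc_baseChange 3 κ 𝔭' γ (W := W)
  obtain ⟨f, hgen⟩ := charIdeal_isPrincipal_holds 3 (XAc (W.baseChange K) 3 κ 𝔭' ∅ γ)
  have hfI : XAc.charIdeal (W.baseChange K) 3 κ 𝔭' ∅ γ = Ideal.span {f} := by
    unfold XAc.charIdeal; rw [hgen, Ideal.submodule_span_eq]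
  have h0 : constantCoeff f ≠ 0 :=
    constantCoeff_charGenerator_ne_zero_of_finite_coinvariants 3 (XAc (W.baseChange K) 3 κ 𝔭' ∅ γ) htor f
      (by unfold XAc.charIdeal at hfI; exact hfI) hfin
  exact h0 (charGenerator_constantCoeff_eq_zero_of_crux hE W N K Dt hO6 hsurj hr1 hN hK hH κ hκ γ 𝔭 h𝔭 he hf 𝔭' h𝔭' hne ι' hι ΩK Ωp L hΩK hΩp hL htor hL0 f hfI)

/-- **E ⟹ where `L(𝟙) = 0`, `Sel_(∅,0)(K_∞, E[3^∞])^{γ}` is INFINITE** (`endInvariants (conjSelmerAc … γ − 1)`,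
the `γ`-fixed part of the anticyclotomic Selmer group dual to `X_(∅,0)`): were it finite, Greenberg's
criterion for the dual pair (`X11b.exists_hasCharValuationAt_of_finite_invariants`) would produce a generator
of `Ch_Λ(X_(∅,0))` with `f(𝟙) ≠ 0`, against the companion's §2. This is Skinner's display (11)
«`L_𝔭^S(f,1) = 0 ⟹ #X_𝔭(f,K,S) = ∞`» over `K_∞` (his (SelmerK-iso) then descends to `K`).
[cite: Skinner2020, §2.7 (arXiv:1405.7294 p. 12)] [cite: GreenbergLNM1716, §4 Lemma 4.2] -/
theorem not_finite_selmerInvariants_of_crux_of_constantCoeff_eq_zero (hE : WildSplitEisensteinInclusionAtThree) :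
    ∀ (W : WeierstrassCurve ℚ) [W.IsElliptic] [W.IsGloballyMinimal] (N : ℕ) [NeZero N] (K : Type) [Field K] [NumberField K] (Dt : Literature.NumberTheory.EllipticCurves.ModularForms.ModularParametrizationData W N), Summit.BirchSwinnertonDyer.Rank1Residual.Additive.ClassO6 W 3 → W.HasSurjectiveModNGaloisRep 3 → W.analyticRank = 1 → W.conductorNorm ℤ = N → Literature.NumberTheory.EllipticCurves.IsImaginaryQuadratic K → Literature.NumberTheory.EllipticCurves.SatisfiesHeegnerHypothesis N K → ∀ (κ : Literature.NumberTheory.EllipticCurves.ZpExtension K 3), κ.IsAnticyclotomic → ∀ (γ : Field.absoluteGaloisGroup K) [Fact (κ.IsTopGenerator γ)] (𝔭 : IsDedekindDomain.HeightOneSpectrum (NumberField.RingOfIntegers K)), ((3 : ℕ) : NumberField.RingOfIntegers K) ∈ 𝔭.asIdeal → 𝔭.asIdeal.ramificationIdx (NumberField.RingOfIntegers ℚ) = 1 → 𝔭.asIdeal.inertiaDeg (NumberField.RingOfIntegers ℚ) = 1 → ∀ (𝔭' : IsDedekindDomain.HeightOneSpectrum (NumberField.RingOfIntegers K)), ((3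 : ℕ) : NumberField.RingOfIntegers K) ∈ 𝔭'.asIdeal → 𝔭' ≠ 𝔭 → ∀ (ι' : PadicAlgCl 3 ≃+* ℂ), Summit.BirchSwinnertonDyer.BirchSwinnertonDyer.Theorems.SchneiderFree.BranchInducesPrime 3 ι' 𝔭 → ∀ (ΩK : ℂ) (Ωp : ℂ_[3]) (L : Literature.NumberTheory.EllipticCurves.UnrSeries 3), ΩK ≠ 0 → Ωp ≠ 0 → Literature.NumberTheory.EllipticCurves.IsBDPLFunction ι' 𝔭 κ γ Dt.f ΩK Ωp L → Module.IsTorsion (Literature.NumberTheory.EllipticCurves.IwasawaAlgebra 3) (Summit.BirchSwinnertonDyer.Rank1Residual.X11b.AcSelmer.XAc (W.baseChange K) 3 κ 𝔭' ∅ γ) → PowerSeries.constantCoeff L = 0 → ¬ Finite (Literature.NumberTheory.EllipticCurves.IwasawaDual.endInvariants (Summit.BirchSwinnertonDyer.Rank1Residual.X11b.AcSelmer.conjSelmerAc (W.baseChange K) 3 κ 𝔭' ∅ γ - 1)) := by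
  intro W _ _ N _ K _ _ Dt hO6 hsurj hr1 hN hK hH κ hκ γ _ 𝔭 h𝔭 he hf 𝔭' h𝔭' hne ι' hι ΩK Ωp L hΩK hΩp hL htor hL0 hfin
  obtain ⟨n, -, f, hfI, hf0, -⟩ := exists_hasCharValuationAt_of_finite_invariants 3 κ 𝔭' γ (W := W) hfin
  exact hf0 (charGenerator_constantCoeff_eq_zero_of_crux hE W N K Dt hO6 hsurj hr1 hN hK hH κ hκ γ 𝔭 h𝔭 he hf 𝔭' h𝔭' hne ι' hι ΩK Ωp L hΩK hΩp hL htor hL0 f hfI)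

/-! ### §3 The corner `y_K` torsion: both statements under the displayed value shape of crux #4 -/

/-- **E at a TORSION point ⟹ `X_(∅,0)/T·X_(∅,0)` and `Sel_(∅,0)(K_∞, E[3^∞])^γ` are INFINITE, given any displayed
value `L(𝟙) = c·(log_ω P / c(Dt))²`.** E's binders VERBATIM with a point `P ∈ E(K)` of FINITE order (the corner
`L(E^{(d_K)},1) = 0`, `y_K` torsion by Gross–Zagier — excluded from cruxes #3–#5 by their binder
`¬ IsOfFinAddOrder P`, NOT excluded from E), the torsion guard, and for every constant `c ∈ ℂ₃` and every
`e : K → ℚ₃` the value shape of crux #4 `WildSplitWaldspurgerAtThree` / the BDP formula at the trivial character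
(`log_ω P = 0` at torsion `P`, `X11b.R1.logOmega_eq_zero_iff`, so `L(𝟙) = 0`). Nothing is asserted about the
value formula; the route's kernel never visits this corner. [cite: Skinner2020, §2.7 (arXiv:1405.7294 p. 12) and Prop. 11]
[cite: BertoliniDarmonPrasanna2013, Thm. 5.13] [cite: SilvermanAEC2009, IV.6.4 and VII.6.3] -/
theorem not_finite_of_crux_of_isOfFinAddOrder (hE : WildSplitEisensteinInclusionAtThree) :
    ∀ (W : WeierstrassCurve ℚ) [W.IsElliptic] [W.IsGloballyMinimal] (N : ℕ) [NeZero N] (K : Type) [Field K] [NumberField K] (Dt : Literature.NumberTheory.EllipticCurves.ModularForms.ModularParametrizationData W N) (P : (W.baseChange K).toAffine.Point), Summit.BirchSwinnertonDyer.Rank1Residual.Additive.ClassO6 W 3 → W.HasSurjectiveModNGaloisRep 3 → W.analyticRank = 1 → W.conductorNorm ℤ = N → Literature.NumberTheory.EllipticCurves.IsImaginaryQuadratic K → Literature.NumberTheory.EllipticCurves.SatisfiesHeegnerHypothesis N K → IsOfFinAddOrder P → ∀ (κ : Literature.NumberTheory.EllipticCurves.ZpExtension K 3), κ.IsAnticyclotomic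 → ∀ (γ : Field.absoluteGaloisGroup K) [Fact (κ.IsTopGenerator γ)] (𝔭 : IsDedekindDomain.HeightOneSpectrum (NumberField.RingOfIntegers K)), ((3 : ℕ) : NumberField.RingOfIntegers K) ∈ 𝔭.asIdeal → 𝔭.asIdeal.ramificationIdx (NumberField.RingOfIntegers ℚ) = 1 → 𝔭.asIdeal.inertiaDeg (NumberField.RingOfIntegers ℚ) = 1 → ∀ (𝔭' : IsDedekindDomain.HeightOneSpectrum (NumberField.RingOfIntegers K)), ((3 : ℕ) : NumberField.RingOfIntegers K) ∈ 𝔭'.asIdeal → 𝔭' ≠ 𝔭 → ∀ (ι' : PadicAlgCl 3 ≃+* ℂ), Summit.BirchSwinnertonDyer.BirchSwinnertonDyer.Theorems.SchneiderFree.BranchInducesPrime 3 ι' 𝔭 → ∀ (ΩK : ℂ) (Ωp : ℂ_[3]) (L : Literature.NumberTheory.EllipticCurves.UnrSeries 3), ΩK ≠ 0 → Ωp ≠ 0 → Literature.NumberTheory.EllipticCurves.IsBDPLFunction ι' 𝔭 κ γ Dt.f ΩK Ωp L → Module.IsTorsion (Literature.NumberTheory.EllipticCurves.IwasawaAlgebra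 3) (Summit.BirchSwinnertonDyer.Rank1Residual.X11b.AcSelmer.XAc (W.baseChange K) 3 κ 𝔭' ∅ γ) → ∀ (c : ℂ_[3]) (e : K →+* ℚ_[3]), L.HasValueAt 0 (c * (algebraMap ℚ_[3] ℂ_[3] (Summit.BirchSwinnertonDyer.Rank1Residual.X11b.Halves.logOmega W 3 e P / (Dt.c : ℚ_[3]))) ^ 2) → ¬ Finite (Literature.NumberTheory.EllipticCurves.IwasawaAlgebra.coinvariants 3 (Summit.BirchSwinnertonDyer.Rank1Residual.X11b.AcSelmer.XAc (W.baseChange K) 3 κ 𝔭' ∅ γ)) ∧ ¬ Finite (Literature.NumberTheory.EllipticCurves.IwasawaDual.endInvariants (Summit.BirchSwinnertonDyer.Rank1Residual.X11b.AcSelmer.conjSelmerAc (W.baseChange K) 3 κ 𝔭' ∅ γ - 1)) := by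
  intro W _ _ N _ K _ _ Dt P hO6 hsurj hr1 hN hK hH hPt κ hκ γ _ 𝔭 h𝔭 he hf 𝔭' h𝔭' hne ι' hι ΩK Ωp L hΩK hΩp hL
    htor c e hval
  have hL0 : constantCoeff L = 0 :=
    constantCoeff_eq_zero_of_hasValueAt_sq_logOmega 3 W e hPt c (Dt.c : ℚ_[3]) hval
  exact ⟨not_finite_coinvariants_of_crux_of_constantCoeff_eq_zero hE W N K Dt hO6 hsurj hr1 hN hK hH κ hκ γ 𝔭 h𝔭 he hf 𝔭' h𝔭' hne ι' hι ΩK Ωp L hΩK hΩp hL htor hL0,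
    not_finite_selmerInvariants_of_crux_of_constantCoeff_eq_zero hE W N K Dt hO6 hsurj hr1 hN hK hH κ hκ γ 𝔭 h𝔭 he hf 𝔭' h𝔭' hne ι' hι ΩK Ωp L hΩK hΩp hL htor hL0⟩

end Summit.BirchSwinnertonDyer.BirchSwinnertonDyer.Theorems.WildSplitEisensteinInclusionAtThreeHigherRankCorner

end
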